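import Mathlib.Algebra.BigOperators.Ring.Finset
import Mathlib.Algebra.Group.Hom.Defs
import Mathlib.Tactic.Ring

/-!
# THE SUPERSINGULAR SHADOW VANISHES FOR EVEN NON-TRIVIAL CHARACTERS — the finite pairing lemma of es §41.15.2 (8a) (T-es-41 (ii), abstract form)
# (cell `bsd-f2-manin`, planner `es` g27; typer g18; theorem-only, sorry-free, nothing conjectured)

TYPER NOTE (typer g18, T-es-41 (ii)).  es's THEOREM 41.15 step (8a) (MEMO-es §41.15.2; ref1 §R139: «character sum over `(ℤ/m)ˣ/±1` vanishes
with no division by 2» — PASS on paper) is the following FINITE lemma, typed here ABSTRACTLY over a finite commutative group `G` (es: `(ℤ[i]/ℓ)ˣ`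
norms, i.e. `𝔽_ℓˣ`), a «sign» `ε ∈ G` with `ε² = 1` (es: `−1`), a HALF-SYSTEM `A` (exactly one of `t`, `εt` in `A`; es: the `μ₄`-orbit
representatives' norm classes mod `±1`), values in a commutative ring `K` with `2 = 0` (es: `𝔽̄₂`), a multiplicative `χ : G →* K` with
`χ(ε) = 1` and `χ ≠ 1` (es: an odd-order, hence even, non-trivial `χ̄`), and shadow sums `S : G → K` with the [j]-SYMMETRY `S(εt) = S(t) + n`
(es's (SYM) `S_{−t} = S_t + #reps`, a consequence of the [j]-lemma landed in `SupersingularShadowLeader.lean` (p707222) and of the module step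
`j(w̄) = δ·w̄`, `N(δ) ≡ −1`, which is NOT typed here):
* `sum_halfSystem_eq_zero` — `Σ_{t ∈ A} χ(t) = 0` with NO division by 2 (the bijection `t ↦ rep_A(t₀t)` of `A`, `χ(t₀) ≠ 1`, `K` without
  zero divisors);
* `sum_mul_eq_zero_of_shadow_symmetry` — in characteristic 2, `Σ_{t ∈ G} χ(t) S(t) = n · Σ_{t ∈ A} χ(t)`, hence `= 0` when the half-system
  sum vanishes;
* `shadow_twisted_sum_eq_zero` — the two combined: `Σ_t χ(t) S(t) = 0`.
The E-facing instantiation (es 41.15 (6)–(8): `m̄₂(χ̄) = 0`, hence `v₂(A(χ)) ≥ …`) needs es's module-theoretic set-up and is NOT asserted here.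
HONEST FRAMING.  LENS: es.  Pure finite algebra; no literature claim; PARTITION currency 0; beyond-print theorem: NO; bears_on:
stmt-BirchSwinnertonDyer-22967 (C2 stub 6⁗ on 32a via E-es-124/128).  BSD is not proved by this; Manin's conjecture is not proved; C2/C3 OPEN.
-/

namespace Summit.BirchSwinnertonDyer.Rank1Residual.ManinAdditive.KatoCurve.ShadowVanishing

variable {G : Type*} [CommGroup G] {K : Type*} [CommRing K]

/-- If `ε² = 1` and `A` is a half-system (`t ∈ A ↔ εt ∉ A`), then `s ∉ A` implies `εs ∈ A`. -/
theorem eps_mul_mem_of_not_mem {ε : G} (hε : ε * ε = 1) {A : Finset G} (hA : ∀ t, t ∈ A ↔ ε * t ∉ A)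
    {s : G} (hs : s ∉ A) : ε * s ∈ A := by
  rw [hA, ← mul_assoc, hε, one_mul]; exact hs

/-- **Half-system character sums vanish, with no division by 2** (es 41.15.2 (8a); ref1 §R139): for a multiplicative `χ : G →* K` into a ring
without zero divisors, trivial on `ε` (`ε² = 1`) and non-trivial somewhere, the sum of `χ` over any half-system `A` of `t ↦ εt` is `0`.
Proof: `t ↦ rep_A(t₀ t)` permutes `A` and multiplies `χ` by `χ(t₀) ≠ 1`. -/
theorem sum_halfSystem_eq_zero [NoZeroDivisors K] (ε : G) (hε : ε * ε = 1) (A : Finset G)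
    (hA : ∀ t, t ∈ A ↔ ε * t ∉ A) (χ : G →* K) (hχε : χ ε = 1) {t₀ : G} (ht₀ : χ t₀ ≠ 1) :
    ∑ t ∈ A, χ t = 0 := by
  classical
  -- the representative in `A` of the pair `{s, ε s}`
  let rep : G → G := fun s => if s ∈ A then s else ε * s
  have rep_of_mem : ∀ s ∈ A, rep s = s := fun s hs => by simp [rep, hs]
  have rep_of_not_mem : ∀ s ∉ A, rep s = ε * s := fun s hs => by simp [rep, hs]
  have rep_mem : ∀ s, rep s ∈ A := by
    intro s
    by_cases hs : s ∈ A
    · rw [rep_of_mem s hs]; exact hs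
    · rw [rep_of_not_mem s hs]; exact eps_mul_mem_of_not_mem hε hA hs
  have rep_eps : ∀ s, rep (ε * s) = rep s := by
    intro s
    by_cases hs : s ∈ A
    · rw [rep_of_mem s hs, rep_of_not_mem (ε * s) ((hA s).mp hs), ← mul_assoc, hε, one_mul]
    · rw [rep_of_not_mem s hs, rep_of_mem (ε * s) (eps_mul_mem_of_not_mem hε hA hs)]
  have χ_rep : ∀ s, χ (rep s) = χ s := by
    intro s
    by_cases hs : s ∈ A
    · rw [rep_of_mem s hs]
    · rw [rep_of_not_mem s hs, map_mul, hχε, one_mul]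
  -- `t ↦ rep (t₀ t)` is a permutation of `A` carrying `χ` to `χ(t₀) · χ`
  have key : ∑ t ∈ A, χ (t₀ * t) = ∑ t ∈ A, χ t := by
    refine Finset.sum_nbij' (fun t => rep (t₀ * t)) (fun t => rep (t₀⁻¹ * t)) (fun t _ => rep_mem _)
      (fun t _ => rep_mem _) ?_ ?_ ?_
    · intro t ht
      by_cases h : t₀ * t ∈ A
      · rw [rep_of_mem _ h, inv_mul_cancel_left, rep_of_mem _ ht]
      · rw [rep_of_not_mem _ h, mul_left_comm, inv_mul_cancel_left, rep_eps, rep_of_mem _ ht]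
    · intro t ht
      by_cases h : t₀⁻¹ * t ∈ A
      · rw [rep_of_mem _ h, mul_inv_cancel_left, rep_of_mem _ ht]
      · rw [rep_of_not_mem _ h, mul_left_comm, mul_inv_cancel_left, rep_eps, rep_of_mem _ ht]
    · intro t _
      exact (χ_rep (t₀ * t)).symm
  have hmul : χ t₀ * ∑ t ∈ A, χ t = ∑ t ∈ A, χ t := by
    rw [Finset.mul_sum]
    simp_rw [← map_mul]
    exact key
  have h1 : (χ t₀ - 1) * ∑ t ∈ A, χ t = 0 := by rw [sub_mul, one_mul, hmul, sub_self]
  rcases mul_eq_zero.mp h1 with h | h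
  · exact absurd (sub_eq_zero.mp h) ht₀
  · exact h

/-- **The pairing lemma in characteristic 2** (es 41.15.2 (8a)): if `S(εt) = S(t) + n` ([j]-symmetry) and `χ(εt) = χ(t)`, then
`Σ_{t ∈ G} χ(t) S(t) = n · Σ_{t ∈ A} χ(t)` over a half-system `A`; in particular it vanishes when the half-system sum does. -/
theorem sum_mul_eq_halfSystem_sum [Fintype G] (h2 : (2 : K) = 0) (ε : G) (hε : ε * ε = 1) (A : Finset G)
    (hA : ∀ t, t ∈ A ↔ ε * t ∉ A) (χ S : G → K) (n : K) (hχε : ∀ t, χ (ε * t) = χ t)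
    (hS : ∀ t, S (ε * t) = S t + n) :
    ∑ t, χ t * S t = n * ∑ t ∈ A, χ t := by
  classical
  have hsplit : ∑ t, χ t * S t = ∑ t ∈ A, χ t * S t + ∑ t ∈ Aᶜ, χ t * S t :=
    (Finset.sum_add_sum_compl A _).symm
  have hcompl : ∑ t ∈ Aᶜ, χ t * S t = ∑ t ∈ A, χ (ε * t) * S (ε * t) := by
    refine Finset.sum_nbij' (fun t => ε * t) (fun t => ε * t) ?_ ?_ ?_ ?_ ?_
    · intro t ht
      rw [Finset.mem_compl] at ht
      exact eps_mul_mem_of_not_mem hε hA ht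
    · intro t ht
      rw [Finset.mem_compl]
      exact (hA t).mp ht
    · intro t _; rw [← mul_assoc, hε, one_mul]
    · intro t _; rw [← mul_assoc, hε, one_mul]
    · intro t _; rw [← mul_assoc, hε, one_mul]
  rw [hsplit, hcompl, ← Finset.sum_add_distrib]
  have hpair : ∀ t ∈ A, χ t * S t + χ (ε * t) * S (ε * t) = n * χ t := by
    intro t _
    rw [hχε, hS]
    have : χ t * S t + χ t * (S t + n) = 2 * (χ t * S t) + n * χ t := by ring
    rw [this, h2, zero_mul, zero_add]
  rw [Finset.sum_congr rfl hpair, ← Finset.mul_sum]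

/-- **The shadow twisted sum vanishes** (T-es-41 (ii), abstract): characteristic 2, `χ : G →* K` multiplicative with `χ(ε) = 1`, `χ(t₀) ≠ 1`,
`K` without zero divisors, `S(εt) = S(t) + n`, `A` any half-system ⟹ `Σ_{t ∈ G} χ(t) S(t) = 0`. -/
theorem shadow_twisted_sum_eq_zero [Fintype G] [NoZeroDivisors K] (h2 : (2 : K) = 0) (ε : G) (hε : ε * ε = 1)
    (A : Finset G) (hA : ∀ t, t ∈ A ↔ ε * t ∉ A) (χ : G →* K) (hχε : χ ε = 1) {t₀ : G} (ht₀ : χ t₀ ≠ 1)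
    (S : G → K) (n : K) (hS : ∀ t, S (ε * t) = S t + n) :
    ∑ t, χ t * S t = 0 := by
  rw [sum_mul_eq_halfSystem_sum h2 ε hε A hA χ S n (fun t => by rw [map_mul, hχε, one_mul]) hS,
    sum_halfSystem_eq_zero ε hε A hA χ hχε ht₀, mul_zero]

end Summit.BirchSwinnertonDyer.Rank1Residual.ManinAdditive.KatoCurve.ShadowVanishing
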